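import Summits.ResolutionOfSingularities.ResolutionOfSingularities.Theorems.LogCanQuotLU.Negative.PlaneWitness
import HarnessLib

/-!
# `LogCanQuotLU` — negative lemmas, part VI: the crux's hypotheses are inhabited (both regimes,
# with ALL finiteness clauses, over a non-trivial valuation ring); `R`-constancy is load-bearing

Support (negative) lemmas for crux `stmt-ResolutionOfSingularities-17082`
(`Summit.ResolutionOfSingularities.ResolutionOfSingularities.Theses.FoliationDescent.LogCanQuotLU`,
route `FoliationDescent`, crux #3 "log-canonical quotients uniformize"), filed by the standing
disprover (cdisprove gen 2; work file `Cruxes/LogCanQuotLU/Disproof.lean` §6). This file declares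
NO definition and NO declaration concludes the route decl positively.

Kernel-checked instances of the FULL hypothesis list of the crux (the part-IV witnesses of
`Negative/FalseWithoutFG.lean` violate `S'.FG` resp. `Frac S' = K` by design), on the plane witness
of part V (`k = 𝔽₂`, `K = 𝔽₂(X₀, X₁)`, `S' = 𝔽₂[X₀, X₁]`, `O` dominating the origin):
* `logCanQuotLU_hypotheses_inhabited_nonsingular` — `D = ∂/∂X₀` (`D ∘ D = 0`), `g = 1`, `R = k`:
  every hypothesis of `LogCanQuotLU` holds, in the NON-SINGULAR branch, and `O ≠ K`;
* `logCanQuotLU_hypotheses_inhabited_singular_multiplicative` — the Euler field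
  `D = X₀∂₀ + X₁∂₁` (`D ∘ D = D`, `u = 1`), `g = 1`, `R = k`: every hypothesis holds, the
  multiplicative clause holds and the non-singular clause FAILS (every value of `D` on `S'_c` is a
  non-unit of `O`) — the regime in which stub `stub_multiplicativeToricLU` of line `birth` has
  content (its constants `𝔽₂[X₀², X₀X₁, X₁²]` are the `A₁` point of part VII);
* `logCanQuotLU_false_without_RConst` — the crux with ONLY the hypothesis "`D x = 0` for `x ∈ R`"
  deleted is FALSE (`R := S' ∋ X₀`, `D X₀ = 1`, but the conclusion forces `R ≤ A ⊆ ker D`).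

## Sources
* N. Jacobson, *Lectures in Abstract Algebra* III (1964), Ch. IV §8 (`p`-closed derivations).
  [folklore computations here]
-/

noncomputable section

set_option linter.dupNamespace false -- mandated namespace of this single-conjunct summit

open IsLocalRing MvPolynomial
open Literature.AlgebraicGeometry.Resolution

namespace Summit.ResolutionOfSingularities.ResolutionOfSingularities.Theorems.LogCanQuotLU.Negative

/-! ## The crux's hypotheses are inhabited — with every finiteness clause, over a non-trivial
valuation ring, in both regimes -/

/-- **Non-vacuity, non-singular branch.** ALL hypotheses of `LogCanQuotLU` are satisfiable at
once over a NON-trivial valuation ring: `p = 2`, `k = 𝔽₂`, `K = 𝔽₂(X₀, X₁)`, `S' = 𝔽₂[X₀, X₁]`,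
`O` dominating the origin, `D = ∂/∂X₀` (`D ∘ D = 0`), `g = 1` (non-singular: `D X₀ = 1`),
`R = 𝔽₂`. (The part-IV witnesses violate `S'.FG` resp. `Frac S' = K` by design.) [folklore] -/
theorem logCanQuotLU_hypotheses_inhabited_nonsingular :
    ¬ (∀ p : ℕ, p.Prime → ∀ (k K : Type) [Field k] [CharP k p] [PerfectField k] [Field K]
        [Algebra k K] (O : ValuationSubring K) (S' : Subalgebra k K)
        (h' : S'.toSubring ≤ O.toSubring) (D : Derivation k K K) (g : K) (R : Subalgebra k K),
        S'.FG → IsFractionRing S' K →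
        IsRegularLocalRing (Localization.AtPrime
          (Ideal.comap (Subring.inclusion h') (IsLocalRing.maximalIdeal O))) →
        D ≠ 0 → (∃ c : K, ∀ x : K, (⇑D)^[p] x = c * D x) → g ≠ 0 →
        (∀ x : K, (∃ a b : K, a ∈ S' ∧ b ∈ S' ∧ b ≠ 0 ∧ b⁻¹ ∈ O ∧ x = a / b) →
          ∃ a b : K, a ∈ S' ∧ b ∈ S' ∧ b ≠ 0 ∧ b⁻¹ ∈ O ∧ (g • D) x = a / b) →
        ((∃ x : K, (∃ a b : K, a ∈ S' ∧ b ∈ S' ∧ b ≠ 0 ∧ b⁻¹ ∈ O ∧ x = a / b) ∧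
            (g • D) x ≠ 0 ∧ ((g • D) x)⁻¹ ∈ O) ∨
          (∃ u : K, (∃ a b : K, a ∈ S' ∧ b ∈ S' ∧ b ≠ 0 ∧ b⁻¹ ∈ O ∧ u = a / b) ∧ u ≠ 0 ∧
            u⁻¹ ∈ O ∧ ∀ x : K, (⇑(g • D))^[p] x = u * (g • D) x)) →
        R.FG → R ≤ S' → (∀ x ∈ R, D x = 0) →
        -- extra information on the witness: the non-singular clause, and `O ≠ K`
        (∃ x : K, (∃ a b : K, a ∈ S' ∧ b ∈ S' ∧ b ≠ 0 ∧ b⁻¹ ∈ O ∧ x = a / b) ∧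
            (g • D) x ≠ 0 ∧ ((g • D) x)⁻¹ ∈ O) →
        (∃ x : K, x ∉ O) → False) := by
  intro h
  classical
  let k : Type := ZMod 2
  let A : Type := MvPolynomial (Fin 2) k
  let K : Type := FractionRing A
  obtain ⟨O, hO₀, hO₁, hO₂⟩ := exists_valuationSubring_dominating_origin k
  set S' : Subalgebra k K := (IsScalarTower.toAlgHom k A K).range with hS'
  have h' : S'.toSubring ≤ O.toSubring := plane_toSubring_le S' hS' O hO₀
  obtain ⟨D, hD, hD0, -, hDD⟩ := exists_pderivZero_plane (k := k)
  have hx₀ : ∃ a b : K, a ∈ S' ∧ b ∈ S' ∧ b ≠ 0 ∧ b⁻¹ ∈ O ∧ algebraMap A K (X 0) = a / b :=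
    (plane_memSc_iff S' hS' O hO₁ hO₂ _).mpr ⟨X 0, 1, by rw [map_one]; exact one_ne_zero,
      by rw [map_one, div_one]⟩
  have hDne : D ≠ 0 := fun h0 => by
    rw [h0, Derivation.zero_apply] at hD0
    exact zero_ne_one hD0
  have hpc : ∃ c : K, ∀ x : K, (⇑D)^[2] x = c * D x := ⟨0, fun x => by rw [zero_mul]; exact hDD x⟩
  have hpres : ∀ x : K, (∃ a b : K, a ∈ S' ∧ b ∈ S' ∧ b ≠ 0 ∧ b⁻¹ ∈ O ∧ x = a / b) →
      ∃ a b : K, a ∈ S' ∧ b ∈ S' ∧ b ≠ 0 ∧ b⁻¹ ∈ O ∧ ((1 : K) • D) x = a / b := fun x hx => by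
    rw [one_smul]
    exact plane_derivation_mapsTo S' hS' O hO₁ hO₂ D (pderiv 0) hD x hx
  have hns : ∃ x : K, (∃ a b : K, a ∈ S' ∧ b ∈ S' ∧ b ≠ 0 ∧ b⁻¹ ∈ O ∧ x = a / b) ∧
      ((1 : K) • D) x ≠ 0 ∧ (((1 : K) • D) x)⁻¹ ∈ O :=
    ⟨algebraMap A K (X 0), hx₀, by rw [one_smul, hD0]; exact one_ne_zero,
      by rw [one_smul, hD0, inv_one]; exact O.one_mem⟩
  have hRconst : ∀ x ∈ (⊥ : Subalgebra k K), D x = 0 := by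
    intro x hx
    obtain ⟨c, rfl⟩ := Algebra.mem_bot.mp hx
    exact D.map_algebraMap c
  have hO : ∃ x : K, x ∉ O := ⟨(algebraMap A K (X 0))⁻¹, fun hmem =>
    X_ne_zero (R := k) (0 : Fin 2) (hO₂ (X 0) (constantCoeff_X k 0) hmem)⟩
  exact h 2 Nat.prime_two k K O S' h' D 1 ⊥ (plane_fg S' hS') (plane_isFractionRing S' hS')
    (plane_isRegularLocalRing_centre S' hS' O h') hDne hpc one_ne_zero hpres (Or.inl hns)
    Subalgebra.fg_bot bot_le hRconst hns hO

/-- **Non-vacuity, SINGULAR MULTIPLICATIVE regime** — where the load-bearing stub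
`stub_multiplicativeToricLU` of line `birth` has content: `p = 2`, `k = 𝔽₂`, `K = 𝔽₂(X₀, X₁)`,
`S' = 𝔽₂[X₀, X₁]`, `O` dominating the origin, `D = X₀∂₀ + X₁∂₁` the Euler field (`D ∘ D = D`:
multiplicative with `u = 1`), `g = 1`, `R = 𝔽₂`; ALL hypotheses of `LogCanQuotLU` hold, the
multiplicative clause holds, and the non-singular clause FAILS (every value of `D` on `S'_c` is a
non-unit of `O`). [folklore] -/
theorem logCanQuotLU_hypotheses_inhabited_singular_multiplicative :
    ¬ (∀ p : ℕ, p.Prime → ∀ (k K : Type) [Field k] [CharP k p] [PerfectField k] [Field K]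
        [Algebra k K] (O : ValuationSubring K) (S' : Subalgebra k K)
        (h' : S'.toSubring ≤ O.toSubring) (D : Derivation k K K) (g : K) (R : Subalgebra k K),
        S'.FG → IsFractionRing S' K →
        IsRegularLocalRing (Localization.AtPrime
          (Ideal.comap (Subring.inclusion h') (IsLocalRing.maximalIdeal O))) →
        D ≠ 0 → (∃ c : K, ∀ x : K, (⇑D)^[p] x = c * D x) → g ≠ 0 →
        (∀ x : K, (∃ a b : K, a ∈ S' ∧ b ∈ S' ∧ b ≠ 0 ∧ b⁻¹ ∈ O ∧ x = a / b) →
          ∃ a b : K, a ∈ S' ∧ b ∈ S' ∧ b ≠ 0 ∧ b⁻¹ ∈ O ∧ (g • D) x = a / b) →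
        ((∃ x : K, (∃ a b : K, a ∈ S' ∧ b ∈ S' ∧ b ≠ 0 ∧ b⁻¹ ∈ O ∧ x = a / b) ∧
            (g • D) x ≠ 0 ∧ ((g • D) x)⁻¹ ∈ O) ∨
          (∃ u : K, (∃ a b : K, a ∈ S' ∧ b ∈ S' ∧ b ≠ 0 ∧ b⁻¹ ∈ O ∧ u = a / b) ∧ u ≠ 0 ∧
            u⁻¹ ∈ O ∧ ∀ x : K, (⇑(g • D))^[p] x = u * (g • D) x)) →
        R.FG → R ≤ S' → (∀ x ∈ R, D x = 0) →
        -- extra information on the witness: multiplicative, SINGULAR, and `O ≠ K`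
        (∃ u : K, (∃ a b : K, a ∈ S' ∧ b ∈ S' ∧ b ≠ 0 ∧ b⁻¹ ∈ O ∧ u = a / b) ∧ u ≠ 0 ∧
            u⁻¹ ∈ O ∧ ∀ x : K, (⇑(g • D))^[p] x = u * (g • D) x) →
        (∀ x : K, (∃ a b : K, a ∈ S' ∧ b ∈ S' ∧ b ≠ 0 ∧ b⁻¹ ∈ O ∧ x = a / b) →
            (g • D) x ≠ 0 → ((g • D) x)⁻¹ ∉ O) →
        (∃ x : K, x ∉ O) → False) := by
  intro h
  classical
  let k : Type := ZMod 2
  let A : Type := MvPolynomial (Fin 2) k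
  let K : Type := FractionRing A
  have hinj : Function.Injective (algebraMap A K) := IsFractionRing.injective A K
  obtain ⟨O, hO₀, hO₁, hO₂⟩ := exists_valuationSubring_dominating_origin k
  set S' : Subalgebra k K := (IsScalarTower.toAlgHom k A K).range with hS'
  have h' : S'.toSubring ≤ O.toSubring := plane_toSubring_le S' hS' O hO₀
  obtain ⟨E, hE, hE0, -, hEE⟩ := exists_eulerDerivation_plane (k := k)
  have h1 : ∃ a b : K, a ∈ S' ∧ b ∈ S' ∧ b ≠ 0 ∧ b⁻¹ ∈ O ∧ (1 : K) = a / b :=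
    (plane_memSc_iff S' hS' O hO₁ hO₂ _).mpr ⟨1, 1, by rw [map_one]; exact one_ne_zero,
      by rw [map_one, div_one]⟩
  have hx₀ : algebraMap A K (X 0) ≠ 0 := (map_ne_zero_iff _ hinj).mpr (X_ne_zero _)
  have hDne : E ≠ 0 := fun h0 => by
    rw [h0, Derivation.zero_apply] at hE0
    exact hx₀ hE0.symm
  have hpc : ∃ c : K, ∀ x : K, (⇑E)^[2] x = c * E x := ⟨1, fun x => by rw [one_mul]; exact hEE x⟩
  have hE' : ∀ a : A, E (algebraMap A K a) = algebraMap A K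
      (((X 0 : A) • (pderiv 0 : Derivation k A A) + (X 1 : A) • (pderiv 1 : Derivation k A A)) a) :=
    fun a => by
      rw [hE, Derivation.add_apply, Derivation.smul_apply, Derivation.smul_apply, smul_eq_mul,
        smul_eq_mul]
  have hpres : ∀ x : K, (∃ a b : K, a ∈ S' ∧ b ∈ S' ∧ b ≠ 0 ∧ b⁻¹ ∈ O ∧ x = a / b) →
      ∃ a b : K, a ∈ S' ∧ b ∈ S' ∧ b ≠ 0 ∧ b⁻¹ ∈ O ∧ ((1 : K) • E) x = a / b := fun x hx => by
    rw [one_smul]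
    exact plane_derivation_mapsTo S' hS' O hO₁ hO₂ E _ hE' x hx
  have hmult : ∃ u : K, (∃ a b : K, a ∈ S' ∧ b ∈ S' ∧ b ≠ 0 ∧ b⁻¹ ∈ O ∧ u = a / b) ∧ u ≠ 0 ∧
      u⁻¹ ∈ O ∧ ∀ x : K, (⇑((1 : K) • E))^[2] x = u * ((1 : K) • E) x :=
    ⟨1, h1, one_ne_zero, by rw [inv_one]; exact O.one_mem, fun x => by
      rw [one_smul, one_mul]; exact hEE x⟩
  have hsing : ∀ x : K, (∃ a b : K, a ∈ S' ∧ b ∈ S' ∧ b ≠ 0 ∧ b⁻¹ ∈ O ∧ x = a / b) →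
      ((1 : K) • E) x ≠ 0 → (((1 : K) • E) x)⁻¹ ∉ O := by
    intro x hx hne hinv
    rw [one_smul] at hne hinv
    obtain ⟨α, β, hβ, rfl⟩ := (plane_memSc_iff S' hS' O hO₁ hO₂ x).mp hx
    have hβK : algebraMap A K β ≠ 0 := (map_ne_zero_iff _ hinj).mpr fun h0 =>
      hβ (by rw [h0, map_zero])
    have hββ : constantCoeff (β * β) ≠ 0 := by
      rw [map_mul]
      exact mul_ne_zero hβ hβ
    set ν : A := β * (X 0 * pderiv 0 α + X 1 * pderiv 1 α) -
      α * (X 0 * pderiv 0 β + X 1 * pderiv 1 β) with hν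
    have hEx : E (algebraMap A K α / algebraMap A K β) =
        algebraMap A K ν / algebraMap A K (β * β) := by
      rw [Derivation.leibniz_div, hE, hE, hν, map_sub, map_mul, map_mul, map_mul, smul_eq_mul,
        smul_eq_mul]
      ring
    have hν0 : constantCoeff ν = 0 := by
      simp only [hν, map_sub, map_mul, map_add, constantCoeff_X, zero_mul, add_zero, mul_zero,
        sub_zero]
    have hνK : algebraMap A K ν ≠ 0 := by
      intro h0
      rw [hEx, h0, zero_div] at hne
      exact hne rfl
    have hinv' : (algebraMap A K ν)⁻¹ ∈ O := by
      have hββK : algebraMap A K (β * β) ≠ 0 := by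
        rw [map_mul]
        exact mul_ne_zero hβK hβK
      have : (algebraMap A K ν)⁻¹ = (E (algebraMap A K α / algebraMap A K β))⁻¹ *
          (algebraMap A K (β * β))⁻¹ := by
        rw [hEx, inv_div, div_mul_eq_mul_div, mul_inv_cancel₀ hββK, one_div]
      rw [this]
      exact O.mul_mem _ _ hinv (hO₁ _ hββ)
    exact hνK (by rw [hO₂ ν hν0 hinv', map_zero])
  have hRconst : ∀ x ∈ (⊥ : Subalgebra k K), E x = 0 := by
    intro x hx
    obtain ⟨c, rfl⟩ := Algebra.mem_bot.mp hx
    exact E.map_algebraMap c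
  have hO : ∃ x : K, x ∉ O := ⟨(algebraMap A K (X 0))⁻¹, fun hmem =>
    X_ne_zero (R := k) (0 : Fin 2) (hO₂ (X 0) (constantCoeff_X k 0) hmem)⟩
  exact h 2 Nat.prime_two k K O S' h' E 1 ⊥ (plane_fg S' hS') (plane_isFractionRing S' hS')
    (plane_isRegularLocalRing_centre S' hS' O h') hDne hpc one_ne_zero hpres (Or.inr hmult)
    Subalgebra.fg_bot bot_le hRconst hmult hsing hO

/-- **`R`-constancy is load-bearing for truth: `LogCanQuotLU` with ONLY the hypothesis
"`D x = 0` for `x ∈ R`" deleted is FALSE** (the non-singular witness above with `R := S'`: the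
conclusion `R ≤ A ⊆ ker D` would force `D X₀ = 0`, but `D X₀ = 1`). [folklore] -/
theorem logCanQuotLU_false_without_RConst :
    ¬ (∀ p : ℕ, p.Prime → ∀ (k K : Type) [Field k] [CharP k p] [PerfectField k] [Field K]
        [Algebra k K] (O : ValuationSubring K) (S' : Subalgebra k K)
        (h' : S'.toSubring ≤ O.toSubring) (D : Derivation k K K) (g : K) (R : Subalgebra k K),
        S'.FG → IsFractionRing S' K →
        IsRegularLocalRing (Localization.AtPrime
          (Ideal.comap (Subring.inclusion h') (IsLocalRing.maximalIdeal O))) →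
        D ≠ 0 → (∃ c : K, ∀ x : K, (⇑D)^[p] x = c * D x) → g ≠ 0 →
        (∀ x : K, (∃ a b : K, a ∈ S' ∧ b ∈ S' ∧ b ≠ 0 ∧ b⁻¹ ∈ O ∧ x = a / b) →
          ∃ a b : K, a ∈ S' ∧ b ∈ S' ∧ b ≠ 0 ∧ b⁻¹ ∈ O ∧ (g • D) x = a / b) →
        ((∃ x : K, (∃ a b : K, a ∈ S' ∧ b ∈ S' ∧ b ≠ 0 ∧ b⁻¹ ∈ O ∧ x = a / b) ∧
            (g • D) x ≠ 0 ∧ ((g • D) x)⁻¹ ∈ O) ∨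
          (∃ u : K, (∃ a b : K, a ∈ S' ∧ b ∈ S' ∧ b ≠ 0 ∧ b⁻¹ ∈ O ∧ u = a / b) ∧ u ≠ 0 ∧
            u⁻¹ ∈ O ∧ ∀ x : K, (⇑(g • D))^[p] x = u * (g • D) x)) →
        R.FG → R ≤ S' →
        ∃ (A : Subalgebra k K) (hA : A.toSubring ≤ O.toSubring), R ≤ A ∧ A.FG ∧
          (∀ x ∈ A, D x = 0) ∧
          (∀ x : K, D x = 0 → ∃ a b : K, a ∈ A ∧ b ∈ A ∧ b ≠ 0 ∧ x = a / b) ∧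
          IsRegularLocalRing (Localization.AtPrime
            (Ideal.comap (Subring.inclusion hA) (IsLocalRing.maximalIdeal O)))) := by
  intro h
  classical
  let k : Type := ZMod 2
  let A : Type := MvPolynomial (Fin 2) k
  let K : Type := FractionRing A
  obtain ⟨O, hO₀, hO₁, hO₂⟩ := exists_valuationSubring_dominating_origin k
  set S' : Subalgebra k K := (IsScalarTower.toAlgHom k A K).range with hS'
  have h' : S'.toSubring ≤ O.toSubring := plane_toSubring_le S' hS' O hO₀
  obtain ⟨D, hD, hD0, -, hDD⟩ := exists_pderivZero_plane (k := k)
  have hx₀S' : algebraMap A K (X 0) ∈ S' := (plane_mem_iff S' hS' _).mpr ⟨X 0, rfl⟩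
  have hx₀ : ∃ a b : K, a ∈ S' ∧ b ∈ S' ∧ b ≠ 0 ∧ b⁻¹ ∈ O ∧ algebraMap A K (X 0) = a / b :=
    (plane_memSc_iff S' hS' O hO₁ hO₂ _).mpr ⟨X 0, 1, by rw [map_one]; exact one_ne_zero,
      by rw [map_one, div_one]⟩
  have hDne : D ≠ 0 := fun h0 => by
    rw [h0, Derivation.zero_apply] at hD0
    exact zero_ne_one hD0
  have hpc : ∃ c : K, ∀ x : K, (⇑D)^[2] x = c * D x := ⟨0, fun x => by rw [zero_mul]; exact hDD x⟩
  have hpres : ∀ x : K, (∃ a b : K, a ∈ S' ∧ b ∈ S' ∧ b ≠ 0 ∧ b⁻¹ ∈ O ∧ x = a / b) →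
      ∃ a b : K, a ∈ S' ∧ b ∈ S' ∧ b ≠ 0 ∧ b⁻¹ ∈ O ∧ ((1 : K) • D) x = a / b := fun x hx => by
    rw [one_smul]
    exact plane_derivation_mapsTo S' hS' O hO₁ hO₂ D (pderiv 0) hD x hx
  have hns : ∃ x : K, (∃ a b : K, a ∈ S' ∧ b ∈ S' ∧ b ≠ 0 ∧ b⁻¹ ∈ O ∧ x = a / b) ∧
      ((1 : K) • D) x ≠ 0 ∧ (((1 : K) • D) x)⁻¹ ∈ O :=
    ⟨algebraMap A K (X 0), hx₀, by rw [one_smul, hD0]; exact one_ne_zero,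
      by rw [one_smul, hD0, inv_one]; exact O.one_mem⟩
  -- the crux WITHOUT the constancy of `R`, at `R := S'`
  obtain ⟨B, -, hS'B, -, hBconst, -, -⟩ :=
    h 2 Nat.prime_two k K O S' h' D 1 S' (plane_fg S' hS') (plane_isFractionRing S' hS')
      (plane_isRegularLocalRing_centre S' hS' O h') hDne hpc one_ne_zero hpres (Or.inl hns)
      (plane_fg S' hS') le_rfl
  have := hBconst _ (hS'B hx₀S')
  rw [hD0] at this
  exact one_ne_zero this

end Summit.ResolutionOfSingularities.ResolutionOfSingularities.Theorems.LogCanQuotLU.Negative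

end
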